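import Mathlib
import Literature.Analysis.ODE.ParametricLinear
import Summits.AtomisticToContinuum.HydrodynamicLimit.Theorems.ImplosionDichotomyDenseExcursionSonicSlavingWedgeLocal

/-!
# Analytic continuation of a smooth radial mode to the whole sonic wedge
# (crux `DenseExcursion`, line `sonic-cavity-renewal` v7, brick "(M3) continued" for the registered stub `stub_sonicSlaving`)

Helper file (`--supports stmt-AtomisticToContinuum-12586`, line lead a2, stub-worker A (wave 3) for `stub_sonicSlaving`).

`smoothMode_wedge_continuation` (registered helper): for a monatomic profile in the cavity tube whose profile continues
holomorphically to the sonic wedge — `Wc, Sc` holomorphic on `sonicWedge` with real traces `W, S` on `(−4/5, 1/20)`, the degenerate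
speed `c₊ = Wc − 1 + Sc` vanishing only at the sonic point and the regular speed `c₋ = Wc − 1 − Sc` nowhere (the qualitative content
of the wedge clause `CavityTubeWedge` of `…SonicCavityDefsC`) — and `Im Λ ≠ 0`, the characteristic pair `(ŵ + 3ŝ, ŵ − 3ŝ)` of every
smooth radial mode is the real trace on `(−4/5, 1/20)` of a pair `(P, M)` HOLOMORPHIC ON THE WHOLE WEDGE and solving the complex
characteristic system there (the input "the smooth mode is single-valued and holomorphic around `[x_m, 0]`" of the contour-transport
estimate for `SonicSlaving`, worker report `work/stubs/W2_sonicSlaving.REPORT.md` §3). Construction: the local holomorphic pair at the sonic point (`smoothMode_analyticAt_sonic` + `complexChar_of_localMode`) is continued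
to the four star-shaped pieces of the punctured wedge (`exists_complexChar_on_starConvex`, i.e. the Literature theorem on linear
holomorphic ODEs on star-shaped domains); neighbouring pieces agree on their convex overlaps through points of the local disc
(`complexChar_agree_on_convex`); the glued pair is holomorphic and solves the system (`complexChar_congr_of_eqOn`); its real trace is
the mode by uniqueness of the REAL characteristic system on `(−4/5, 0)` and `(0, 1/20)` (`realTrace_of_complexChar`). [folklore]
-/

noncomputable section

open Set Filter Metric Complex
open scoped Topology

namespace Summit.AtomisticToContinuum.HydrodynamicLimit.Theorems.SonicCavityRenewal

open Summit.AtomisticToContinuum.HydrodynamicLimit.Theorems.R2OneModeTwoConditions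

/-! ## Real traces: uniqueness of the real-parameter system -/

/-- **REAL TRACE OF A COMPLEX SOLUTION = THE MODE, by uniqueness of the real characteristic system.** Let `(P, M)` be holomorphic on
an open `V ⊆ sonicWedge` avoiding the zeros of `c±` and solve the complex characteristic system there; let the real interval
`(a, b)` map into `V`; let `(ŵ, ŝ)` be a differentiable solution of the mode equations. If `P = ŵ + 3ŝ`, `M = ŵ − 3ŝ` at one point
`x₀ ∈ (a, b)`, then on all of `(a, b)`: both real-parameter pairs solve the regular linear system `v′ = A(t) v` with continuous
coefficient (`Literature.Analysis.ODE.eqOn_of_hasDerivAt_linear`). [folklore] -/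
theorem realTrace_of_complexChar {r : ℝ} {W S : ℝ → ℝ} {Wc Sc : ℂ → ℂ} {Λ : ℂ} {ŵ ŝ : ℝ → ℂ} {V : Set ℂ} {P M : ℂ → ℂ}
    {a b x₀ : ℝ} (hV : IsOpen V) (hVW : V ⊆ sonicWedge) (hW : Differentiable ℝ W) (hS : Differentiable ℝ S)
    (hWc : DifferentiableOn ℂ Wc sonicWedge) (hSc : DifferentiableOn ℂ Sc sonicWedge)
    (htr : ∀ x : ℝ, -(4 / 5 : ℝ) < x → x < 1 / 20 → Wc x = W x ∧ Sc x = S x) (hcp : ∀ z ∈ V, Wc z - 1 + Sc z ≠ 0)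
    (hcm : ∀ z ∈ V, Wc z - 1 - Sc z ≠ 0) (hŵ : Differentiable ℝ ŵ) (hŝ : Differentiable ℝ ŝ)
    (heq : ∀ x, Λ * ŵ x = linW r W S ŵ ŝ x ∧ Λ * ŝ x = linS r W S ŵ ŝ x) (hP : DifferentiableOn ℂ P V)
    (hM : DifferentiableOn ℂ M V)
    (hsol : ∀ z ∈ V, (Wc z - 1 + Sc z) * deriv P z = (Λ - (2 / 3 * deriv Wc z + 2 * Wc z - r + 2 * deriv Sc z + 4 * Sc z)) * P z -
        (deriv Wc z / 3 + deriv Sc z + 2 * Sc z) * M z ∧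
      (Wc z - 1 - Sc z) * deriv M z = -(deriv Wc z / 3 - deriv Sc z - 2 * Sc z) * P z +
        (Λ - (2 / 3 * deriv Wc z + 2 * Wc z - r - 2 * deriv Sc z - 4 * Sc z)) * M z)
    (hab : ∀ x ∈ Ioo a b, (x : ℂ) ∈ V) (hx₀ : x₀ ∈ Ioo a b) (h0 : P x₀ = ŵ x₀ + 3 * ŝ x₀ ∧ M x₀ = ŵ x₀ - 3 * ŝ x₀) :
    ∀ x ∈ Ioo a b, P x = ŵ x + 3 * ŝ x ∧ M x = ŵ x - 3 * ŝ x := by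
  obtain ⟨A, hAd, hA⟩ := exists_charOperator r Wc Sc Λ hVW hWc hSc hcp hcm
  -- the real coefficient operator and its continuity
  set B : ℝ → (ℂ × ℂ →L[ℝ] ℂ × ℂ) := fun t =>
    ContinuousLinearMap.restrictScalarsIsometry ℂ (ℂ × ℂ) (ℂ × ℂ) ℝ ℝ (A t) with hB
  have hBapp : ∀ (t : ℝ) (v : ℂ × ℂ), B t v = A t v := fun t v => rfl
  have hAc : ContinuousOn (fun t : ℝ => A t) (Ioo a b) :=
    hAd.continuousOn.comp Complex.continuous_ofReal.continuousOn fun t ht => hab t ht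
  have hBc : ContinuousOn B (Ioo a b) :=
    (ContinuousLinearMap.restrictScalarsIsometry ℂ (ℂ × ℂ) (ℂ × ℂ) ℝ ℝ).continuous.comp_continuousOn hAc
  -- the complex solution along the real axis
  have hf : ∀ t ∈ Ioo a b, HasDerivAt (fun s : ℝ => (P s, M s)) (B t (P t, M t)) t := by
    intro t ht
    have hc := hasDerivAt_pair_of_complexChar hA hV hP hM (hab t ht) (hcp _ (hab t ht)) (hcm _ (hab t ht))
      (hsol _ (hab t ht)).1 (hsol _ (hab t ht)).2
    have dP : HasDerivAt P (deriv P t) t := (hP.differentiableAt (hV.mem_nhds (hab t ht))).hasDerivAt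
    have dM : HasDerivAt M (deriv M t) t := (hM.differentiableAt (hV.mem_nhds (hab t ht))).hasDerivAt
    have e : (deriv P (t : ℂ), deriv M (t : ℂ)) = A t (P t, M t) + 0 := (dP.prodMk dM).unique hc
    refine (dP.comp_ofReal.prodMk dM.comp_ofReal).congr_deriv ?_
    rw [hBapp, e, add_zero]
  -- the mode along the real axis
  have hg : ∀ t ∈ Ioo a b, HasDerivAt (fun s : ℝ => (ŵ s + 3 * ŝ s, ŵ s - 3 * ŝ s)) (B t (ŵ t + 3 * ŝ t, ŵ t - 3 * ŝ t)) t := by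
    intro t ht
    have htW : (t : ℂ) ∈ sonicWedge := hVW (hab t ht)
    obtain ⟨ht1, ht2, -⟩ := mem_sonicWedge_iff.1 htW
    simp only [Complex.ofReal_re] at ht1 ht2
    obtain ⟨eW, eS⟩ := htr t ht1 ht2
    have edW := deriv_continuation_ofReal hWc hW (fun s h1 h2 => (htr s h1 h2).1) ht1 ht2
    have edS := deriv_continuation_ofReal hSc hS (fun s h1 h2 => (htr s h1 h2).2) ht1 ht2
    have hcpt : ((W t : ℝ) : ℂ) - 1 + S t ≠ 0 := by
      have := hcp _ (hab t ht); rwa [eW, eS] at this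
    have hcmt : ((W t : ℝ) : ℂ) - 1 - S t ≠ 0 := by
      have := hcm _ (hab t ht); rwa [eW, eS] at this
    obtain ⟨c1, c2⟩ := mode_char_system (heq t)
    push_cast at c1 c2
    obtain ⟨dp, dm⟩ := hasDerivAt_char_components (hŵ t) (hŝ t)
    refine (dp.prodMk dm).congr_deriv ?_
    rw [hBapp, hA, eW, eS, edW, edS]
    have aux1 : ∀ (c' X Y p m d : ℂ), c' ≠ 0 → c' * d = X * p + Y * m → d = X / c' * p + Y / c' * m := by
      intro c' X Y p m d hc' h
      field_simp
      linear_combination h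
    have e1 := aux1 (((W t : ℝ) : ℂ) - 1 + ((S t : ℝ) : ℂ))
      (Λ - (2 / 3 * ((deriv W t : ℝ) : ℂ) + 2 * ((W t : ℝ) : ℂ) - r + 2 * ((deriv S t : ℝ) : ℂ) + 4 * ((S t : ℝ) : ℂ)))
      (-(((deriv W t : ℝ) : ℂ) / 3 + ((deriv S t : ℝ) : ℂ) + 2 * ((S t : ℝ) : ℂ))) (ŵ t + 3 * ŝ t) (ŵ t - 3 * ŝ t)
      (deriv ŵ t + 3 * deriv ŝ t) hcpt (by linear_combination c1)
    have e2 := aux1 (((W t : ℝ) : ℂ) - 1 - ((S t : ℝ) : ℂ))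
      (-(((deriv W t : ℝ) : ℂ) / 3 - ((deriv S t : ℝ) : ℂ) - 2 * ((S t : ℝ) : ℂ)))
      (Λ - (2 / 3 * ((deriv W t : ℝ) : ℂ) + 2 * ((W t : ℝ) : ℂ) - r - 2 * ((deriv S t : ℝ) : ℂ) - 4 * ((S t : ℝ) : ℂ)))
      (ŵ t + 3 * ŝ t) (ŵ t - 3 * ŝ t) (deriv ŵ t - 3 * deriv ŝ t) hcmt (by linear_combination c2)
    rw [e1, e2]
  have key := Literature.Analysis.ODE.eqOn_of_hasDerivAt_linear hx₀ hBc hf hg (by simp [h0.1, h0.2])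
  intro x hx
  simpa only [Prod.mk.injEq] using key hx



/-! ## Gluing -/

/-- Two differentiable solutions of the complex characteristic system on an open CONVEX subset of the punctured wedge which agree at
one point agree on the subset (uniqueness on star-shaped sets, `exists_complexChar_on_starConvex`). [folklore] -/
theorem complexChar_agree_on_convex {r : ℝ} {Wc Sc : ℂ → ℂ} {Λ : ℂ} {U : Set ℂ} {d : ℂ} (hU : IsOpen U) (hUc : Convex ℝ U)
    (hd : d ∈ U) (hUW : U ⊆ sonicWedge) (hWc : DifferentiableOn ℂ Wc sonicWedge) (hSc : DifferentiableOn ℂ Sc sonicWedge)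
    (hcp : ∀ z ∈ U, Wc z - 1 + Sc z ≠ 0) (hcm : ∀ z ∈ U, Wc z - 1 - Sc z ≠ 0) {P₁ M₁ P₂ M₂ : ℂ → ℂ}
    (hP₁ : DifferentiableOn ℂ P₁ U) (hM₁ : DifferentiableOn ℂ M₁ U) (hP₂ : DifferentiableOn ℂ P₂ U)
    (hM₂ : DifferentiableOn ℂ M₂ U) (h₁ : ∀ z ∈ U, (Wc z - 1 + Sc z) * deriv P₁ z = (Λ - (2 / 3 * deriv Wc z + 2 * Wc z - r + 2 * deriv Sc z + 4 * Sc z)) * P₁ z - (deriv Wc z / 3 + deriv Sc z + 2 * Sc z) * M₁ z ∧ (Wc z - 1 - Sc z) * deriv M₁ z = -(deriv Wc z / 3 - deriv Sc z - 2 * Sc z) * P₁ z + (Λ - (2 / 3 * deriv Wc z + 2 * Wc z - r - 2 * deriv Sc z - 4 * Sc z)) * M₁ z) (h₂ : ∀ z ∈ U, (Wc z - 1 + Sc z) * deriv P₂ z = (Λ - (2 / 3 * deriv Wc z + 2 * Wc z - r + 2 * deriv Sc z + 4 * Sc z)) * P₂ z - (deriv Wc z / 3 + deriv Sc z + 2 *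 Sc z) * M₂ z ∧ (Wc z - 1 - Sc z) * deriv M₂ z = -(deriv Wc z / 3 - deriv Sc z - 2 * Sc z) * P₂ z + (Λ - (2 / 3 * deriv Wc z + 2 * Wc z - r - 2 * deriv Sc z - 4 * Sc z)) * M₂ z) (hPd : P₁ d = P₂ d) (hMd : M₁ d = M₂ d) :
    ∀ z ∈ U, P₁ z = P₂ z ∧ M₁ z = M₂ z := by
  obtain ⟨Q, N, -, -, -, -, -, huniq⟩ := exists_complexChar_on_starConvex r Wc Sc Λ U d (P₂ d) (M₂ d) hU (hUc.starConvex hd) hd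
    hUW hWc hSc hcp hcm
  intro z hz
  obtain ⟨a1, b1⟩ := huniq P₁ M₁ hP₁ hM₁ hPd hMd h₁ z hz
  obtain ⟨a2, b2⟩ := huniq P₂ M₂ hP₂ hM₂ rfl rfl h₂ z hz
  exact ⟨a1.trans a2.symm, b1.trans b2.symm⟩

/-- Transfer of differentiability and of the system along agreement on an open set. [folklore] -/
theorem complexChar_congr_of_eqOn {r : ℝ} {Wc Sc : ℂ → ℂ} {Λ : ℂ} {U : Set ℂ} (hU : IsOpen U) {P M Q N : ℂ → ℂ}
    (hQ : DifferentiableOn ℂ Q U) (hN : DifferentiableOn ℂ N U) (hsol : ∀ z ∈ U, (Wc z - 1 + Sc z) * deriv Q z = (Λ - (2 / 3 * deriv Wc z + 2 * Wc z - r + 2 * deriv Sc z + 4 * Sc z)) * Q z - (deriv Wc z / 3 + deriv Sc z + 2 * Sc z) * N z ∧ (Wc z - 1 - Sc z) * deriv N z = -(deriv Wc z / 3 - deriv Sc z - 2 * Sc z) * Q z + (Λ - (2 / 3 * deriv Wc z + 2 * Wc z - r - 2 * deriv Sc z - 4 * Sc z)) * N z) (hP : EqOn P Q U) (hM : EqOn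 M N U)
    {z : ℂ} (hz : z ∈ U) : DifferentiableAt ℂ P z ∧ DifferentiableAt ℂ M z ∧ ((Wc z - 1 + Sc z) * deriv P z = (Λ - (2 / 3 * deriv Wc z + 2 * Wc z - r + 2 * deriv Sc z + 4 * Sc z)) * P z - (deriv Wc z / 3 + deriv Sc z + 2 * Sc z) * M z ∧ (Wc z - 1 - Sc z) * deriv M z = -(deriv Wc z / 3 - deriv Sc z - 2 * Sc z) * P z + (Λ - (2 / 3 * deriv Wc z + 2 * Wc z - r - 2 * deriv Sc z - 4 * Sc z)) * M z) := by
  have eP : P =ᶠ[𝓝 z] Q := hP.eventuallyEq_of_mem (hU.mem_nhds hz)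
  have eM : M =ᶠ[𝓝 z] N := hM.eventuallyEq_of_mem (hU.mem_nhds hz)
  refine ⟨(hQ.differentiableAt (hU.mem_nhds hz)).congr_of_eventuallyEq eP,
    (hN.differentiableAt (hU.mem_nhds hz)).congr_of_eventuallyEq eM, ?_⟩
  rw [eP.deriv_eq, eM.deriv_eq, hP hz, hM hz]
  exact hsol z hz

/-- **ANALYTIC CONTINUATION OF A SMOOTH RADIAL MODE TO THE WHOLE SONIC WEDGE** — registered helper `smoothMode_wedge_continuation`
for `stub_sonicSlaving`. For a monatomic profile in the cavity tube whose profile continues holomorphically to the sonic wedge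
(`Wc, Sc` with real traces `W, S`, `c₊ ≠ 0` off the sonic point, `c₋ ≠ 0` — the qualitative part of `CavityTubeWedge`), and
`Im Λ ≠ 0`, the characteristic pair `(p, m) = (ŵ + 3ŝ, ŵ − 3ŝ)` of every smooth radial mode is the real trace on `(−4/5, 1/20)` of a
pair `(P, M)` HOLOMORPHIC ON THE WHOLE WEDGE solving the complex characteristic system there. Construction: the local holomorphic
pair at the sonic point (`smoothMode_analyticAt_sonic`, `complexChar_of_localMode`) is continued to the four star-shaped pieces of
the punctured wedge (`exists_complexChar_on_starConvex`); the pieces agree on overlaps by uniqueness on convex sets; the real trace is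
identified by uniqueness of the real characteristic system (`realTrace_of_complexChar`). [folklore] -/
theorem smoothMode_wedge_continuation : ∀ (r : ℝ) (W S : ℝ → ℝ) (Wc Sc : ℂ → ℂ) (Λ : ℂ) (ŵ ŝ : ℝ → ℂ), IsMonatomicProfile r W S → CavityTube r W S → DifferentiableOn ℂ Wc sonicWedge → DifferentiableOn ℂ Sc sonicWedge → (∀ x : ℝ, -(4 / 5 : ℝ) < x → x < 1 / 20 → Wc x = W x ∧ Sc x = S x) → (∀ z ∈ sonicWedge, z ≠ 0 → Wc z - 1 + Sc z ≠ 0) → (∀ z ∈ sonicWedge, Wc z - 1 - Sc z ≠ 0) → Λ.im ≠ 0 → IsSmoothRadialMode r W S Λ ŵ ŝ → ∃ P M : ℂ → ℂ, DifferentiableOn ℂ P sonicWedge ∧ DifferentiableOn ℂ M sonicWedge ∧ (∀ x : ℝ, -(4 / 5 : ℝ) < x → x < 1 / 20 → P x = ŵ x + 3 * ŝ x ∧ M x = ŵ x - 3 * ŝ x) ∧ ∀ z ∈ sonicWedge, (Wc z - 1 + Sc z) * deriv P z = (Λ - (2 / 3 * deriv Wc z + 2 * Wc z - r + 2 * deriv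 Sc z + 4 * Sc z)) * P z - (deriv Wc z / 3 + deriv Sc z + 2 * Sc z) * M z ∧ (Wc z - 1 - Sc z) * deriv M z = -(deriv Wc z / 3 - deriv Sc z - 2 * Sc z) * P z + (Λ - (2 / 3 * deriv Wc z + 2 * Wc z - r - 2 * deriv Sc z - 4 * Sc z)) * M z := by
  intro r W S Wc Sc Λ ŵ ŝ hP hT hWc hSc htr hcp hcm hΛ hmode
  obtain ⟨-, -, hWsm, hSsm, -, -⟩ := id hP
  have hW : Differentiable ℝ W := hWsm.differentiable (by simp)
  have hS : Differentiable ℝ S := hSsm.differentiable (by simp)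
  obtain ⟨⟨hŵsm, hŝsm, -⟩, -, heq⟩ := id hmode
  have hŵ : Differentiable ℝ ŵ := hŵsm.differentiable (by simp)
  have hŝ : Differentiable ℝ ŝ := hŝsm.differentiable (by simp)
  -- the local holomorphic pair on `‖z‖ < δ`, `δ ≤ 1/20`
  obtain ⟨δ₀, hδ₀, F, G, hFd, hGd, htrFG⟩ := smoothMode_analyticAt_sonic r W S Λ ŵ ŝ hP hT hΛ hmode
  set δ : ℝ := min δ₀ (1 / 20) with hδ
  have hδpos : 0 < δ := lt_min hδ₀ (by norm_num)
  have hδ20 : δ ≤ 1 / 20 := min_le_right _ _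
  have hδδ₀ : δ ≤ δ₀ := min_le_left _ _
  have hBW : ball (0 : ℂ) δ ⊆ sonicWedge := ball_subset_sonicWedge hδ20
  set P₀ : ℂ → ℂ := fun z => F z + 3 * G z with hP₀
  set M₀ : ℂ → ℂ := fun z => F z - 3 * G z with hM₀
  have hP₀d : DifferentiableOn ℂ P₀ (ball 0 δ) := (hFd.add (hGd.const_mul 3)).mono (ball_subset_ball hδδ₀)
  have hM₀d : DifferentiableOn ℂ M₀ (ball 0 δ) := (hFd.sub (hGd.const_mul 3)).mono (ball_subset_ball hδδ₀)
  have htr0 : ∀ x : ℝ, |x| < δ → P₀ x = ŵ x + 3 * ŝ x ∧ M₀ x = ŵ x - 3 * ŝ x := fun x hx => by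
    obtain ⟨e1, e2⟩ := htrFG x (hx.trans_le hδδ₀)
    simp only [hP₀, hM₀, e1, e2]
    exact ⟨trivial, trivial⟩
  have hsol0 := complexChar_of_localMode r W S Wc Sc Λ ŵ ŝ P₀ M₀ δ hW hS hWc hSc htr hŵ hŝ heq hδpos hδ20 hP₀d hM₀d htr0
  -- nonvanishing of the speeds on the punctured wedge
  have hcp0 : ∀ (T : Set ℂ), T ⊆ sonicWedge → (∀ z ∈ T, z ≠ 0) → ∀ z ∈ T, Wc z - 1 + Sc z ≠ 0 :=
    fun T hT h0 z hz => hcp z (hT hz) (h0 z hz)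
  have hcm0 : ∀ (T : Set ℂ), T ⊆ sonicWedge → ∀ z ∈ T, Wc z - 1 - Sc z ≠ 0 := fun T hT z hz => hcm z (hT hz)
  -- the four pieces
  obtain ⟨hO1, hO2, hO3, hO4⟩ := isOpen_sonicWedge_pieces
  obtain ⟨hC2, hC3, hC4⟩ := convex_sonicWedge_pieces
  set V₁ : Set ℂ := sonicWedge ∩ {z : ℂ | z.re < 0} with hV₁
  set V₂ : Set ℂ := sonicWedge ∩ {z : ℂ | 0 < z.im ∧ z.im < 1 / 20} with hV₂
  set V₃ : Set ℂ := sonicWedge ∩ {z : ℂ | z.im < 0 ∧ -(1 / 20 : ℝ) < z.im} with hV₃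
  set V₄ : Set ℂ := sonicWedge ∩ {z : ℂ | 0 < z.re} with hV₄
  have h01 : ∀ z ∈ V₁, z ≠ 0 := fun z hz => zero_notMem_sonicWedge_pieces (Or.inl hz.2)
  have h02 : ∀ z ∈ V₂, z ≠ 0 := fun z hz => zero_notMem_sonicWedge_pieces (Or.inr (Or.inr (Or.inl hz.2)))
  have h03 : ∀ z ∈ V₃, z ≠ 0 := fun z hz => zero_notMem_sonicWedge_pieces (Or.inr (Or.inr (Or.inr hz.2)))
  have h04 : ∀ z ∈ V₄, z ≠ 0 := fun z hz => zero_notMem_sonicWedge_pieces (Or.inr (Or.inl hz.2))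
  -- the centres
  set c₁ : ℂ := ((-(δ / 2) : ℝ) : ℂ) with hc₁
  set c₂ : ℂ := ((δ / 2 : ℝ) : ℂ) * Complex.I with hc₂
  set c₃ : ℂ := ((-(δ / 2) : ℝ) : ℂ) * Complex.I with hc₃
  set c₄ : ℂ := ((δ / 2 : ℝ) : ℂ) with hc₄
  have hn2 : ‖((δ / 2 : ℝ) : ℂ)‖ = δ / 2 ∧ ‖((-(δ / 2) : ℝ) : ℂ)‖ = δ / 2 := by
    rw [Complex.norm_real, Complex.norm_real, Real.norm_eq_abs, Real.norm_eq_abs, abs_of_pos (by linarith),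
      abs_of_neg (by linarith)]; exact ⟨rfl, by ring⟩
  have hc₁B : c₁ ∈ ball (0 : ℂ) δ := by rw [mem_ball_zero_iff, hc₁, hn2.2]; linarith
  have hc₂B : c₂ ∈ ball (0 : ℂ) δ := by rw [mem_ball_zero_iff, hc₂, norm_mul, Complex.norm_I, mul_one, hn2.1]; linarith
  have hc₃B : c₃ ∈ ball (0 : ℂ) δ := by rw [mem_ball_zero_iff, hc₃, norm_mul, Complex.norm_I, mul_one, hn2.2]; linarith
  have hc₄B : c₄ ∈ ball (0 : ℂ) δ := by rw [mem_ball_zero_iff, hc₄, hn2.1]; linarith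
  have hc₁V : c₁ ∈ V₁ := ⟨hBW hc₁B, by simp [hc₁]; linarith⟩
  have hc₂V : c₂ ∈ V₂ := ⟨hBW hc₂B, by simp [hc₂, hc₄]; constructor <;> linarith⟩
  have hc₃V : c₃ ∈ V₃ := ⟨hBW hc₃B, by simp [hc₃]; constructor <;> linarith⟩
  have hc₄V : c₄ ∈ V₄ := ⟨hBW hc₄B, by simp [hc₄]; linarith⟩
  -- solutions on the pieces through the local values at the centres
  obtain ⟨P₁, M₁, hP₁d, hM₁d, hP₁c, hM₁c, hsol₁, -⟩ := exists_complexChar_on_starConvex r Wc Sc Λ V₁ c₁ (P₀ c₁) (M₀ c₁) hO1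
    (starConvex_sonicWedge_left (c := -(δ / 2)) (by linarith) (by linarith)) hc₁V inter_subset_left hWc hSc
    (hcp0 V₁ inter_subset_left h01) (hcm0 V₁ inter_subset_left)
  obtain ⟨P₂, M₂, hP₂d, hM₂d, hP₂c, hM₂c, hsol₂, -⟩ := exists_complexChar_on_starConvex r Wc Sc Λ V₂ c₂ (P₀ c₂) (M₀ c₂) hO2
    (hC2.starConvex hc₂V) hc₂V inter_subset_left hWc hSc (hcp0 V₂ inter_subset_left h02) (hcm0 V₂ inter_subset_left)
  obtain ⟨P₃, M₃, hP₃d, hM₃d, hP₃c, hM₃c, hsol₃, -⟩ := exists_complexChar_on_starConvex r Wc Sc Λ V₃ c₃ (P₀ c₃) (M₀ c₃) hO3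
    (hC3.starConvex hc₃V) hc₃V inter_subset_left hWc hSc (hcp0 V₃ inter_subset_left h03) (hcm0 V₃ inter_subset_left)
  obtain ⟨P₄, M₄, hP₄d, hM₄d, hP₄c, hM₄c, hsol₄, -⟩ := exists_complexChar_on_starConvex r Wc Sc Λ V₄ c₄ (P₀ c₄) (M₀ c₄) hO4
    (hC4.starConvex hc₄V) hc₄V inter_subset_left hWc hSc (hcp0 V₄ inter_subset_left h04) (hcm0 V₄ inter_subset_left)
  -- agreement with the local pair on (piece ∩ disc): convex sets containing the centres
  have hOB : IsOpen (ball (0 : ℂ) δ) := isOpen_ball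
  have agree0 : ∀ (X : Set ℂ) (c : ℂ) (Pj Mj : ℂ → ℂ), IsOpen X → Convex ℝ X → c ∈ ball (0 : ℂ) δ ∩ X →
      DifferentiableOn ℂ Pj (sonicWedge ∩ X) → DifferentiableOn ℂ Mj (sonicWedge ∩ X) →
      (∀ z ∈ sonicWedge ∩ X, z ≠ 0) → (∀ z ∈ sonicWedge ∩ X, (Wc z - 1 + Sc z) * deriv Pj z = (Λ - (2 / 3 * deriv Wc z + 2 * Wc z - r + 2 * deriv Sc z + 4 * Sc z)) * Pj z - (deriv Wc z / 3 + deriv Sc z + 2 * Sc z) * Mj z ∧ (Wc z - 1 - Sc z) * deriv Mj z = -(deriv Wc z / 3 - deriv Sc z - 2 * Sc z) * Pj z + (Λ - (2 / 3 * deriv Wc z + 2 * Wc z - r - 2 * deriv Sc z - 4 * Sc z)) * Mj z) → Pj c = P₀ c → Mj c = M₀ c →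
      ∀ z ∈ ball (0 : ℂ) δ ∩ X, Pj z = P₀ z ∧ Mj z = M₀ z := by
    intro X c Pj Mj hX hXc hc hPj hMj h0X hsolj hPc hMc
    have hsub1 : ball (0 : ℂ) δ ∩ X ⊆ sonicWedge ∩ X := inter_subset_inter_left _ hBW
    have hsub0 : ball (0 : ℂ) δ ∩ X ⊆ ball 0 δ := inter_subset_left
    exact complexChar_agree_on_convex (hOB.inter hX) ((convex_ball _ _).inter hXc) hc (hsub0.trans hBW) hWc hSc
      (fun z hz => hcp z (hBW hz.1) (h0X z (hsub1 hz))) (fun z hz => hcm z (hBW hz.1)) (hPj.mono hsub1) (hMj.mono hsub1)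
      (hP₀d.mono hsub0) (hM₀d.mono hsub0) (fun z hz => hsolj z (hsub1 hz)) (fun z hz => hsol0 z (hsub0 hz)) hPc hMc
  have hA1 := agree0 {z : ℂ | z.re < 0} c₁ P₁ M₁ (isOpen_lt continuous_re continuous_const) (convex_halfSpace_re_lt 0)
    ⟨hc₁B, hc₁V.2⟩ hP₁d hM₁d h01 hsol₁ hP₁c hM₁c
  have hA2 := agree0 {z : ℂ | 0 < z.im ∧ z.im < 1 / 20} c₂ P₂ M₂
    ((isOpen_lt continuous_const continuous_im).inter (isOpen_lt continuous_im continuous_const))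
    ((convex_halfSpace_im_gt 0).inter (convex_halfSpace_im_lt _)) ⟨hc₂B, hc₂V.2⟩ hP₂d hM₂d h02 hsol₂ hP₂c hM₂c
  have hA3 := agree0 {z : ℂ | z.im < 0 ∧ -(1 / 20 : ℝ) < z.im} c₃ P₃ M₃
    ((isOpen_lt continuous_im continuous_const).inter (isOpen_lt continuous_const continuous_im))
    ((convex_halfSpace_im_lt 0).inter (convex_halfSpace_im_gt _)) ⟨hc₃B, hc₃V.2⟩ hP₃d hM₃d h03 hsol₃ hP₃c hM₃c
  have hA4 := agree0 {z : ℂ | 0 < z.re} c₄ P₄ M₄ (isOpen_lt continuous_const continuous_re) (convex_halfSpace_re_gt 0)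
    ⟨hc₄B, hc₄V.2⟩ hP₄d hM₄d h04 hsol₄ hP₄c hM₄c
  -- pairwise agreement on the (convex) overlaps, through points of the disc
  have agree2 : ∀ (Vi X : Set ℂ) (d : ℂ) (Pi Mi Pj Mj : ℂ → ℂ), IsOpen Vi → IsOpen X → Convex ℝ (Vi ∩ X) → Vi ⊆ sonicWedge →
      (∀ z ∈ Vi, z ≠ 0) → d ∈ Vi ∩ X → DifferentiableOn ℂ Pi Vi → DifferentiableOn ℂ Mi Vi → (∀ z ∈ Vi, (Wc z - 1 + Sc z) * deriv Pi z = (Λ - (2 / 3 * deriv Wc z + 2 * Wc z - r + 2 * deriv Sc z + 4 * Sc z)) * Pi z - (deriv Wc z / 3 + deriv Sc z + 2 * Sc z) * Mi z ∧ (Wc z - 1 - Sc z) * deriv Mi z = -(deriv Wc z / 3 - deriv Sc z - 2 * Sc z) * Pi z + (Λ - (2 / 3 * deriv Wc z + 2 * Wc z - r - 2 * deriv Sc z - 4 * Sc z)) * Mi z) →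
      DifferentiableOn ℂ Pj (sonicWedge ∩ X) → DifferentiableOn ℂ Mj (sonicWedge ∩ X) → (∀ z ∈ sonicWedge ∩ X, (Wc z - 1 + Sc z) * deriv Pj z = (Λ - (2 / 3 * deriv Wc z + 2 * Wc z - r + 2 * deriv Sc z + 4 * Sc z)) * Pj z - (deriv Wc z / 3 + deriv Sc z + 2 * Sc z) * Mj z ∧ (Wc z - 1 - Sc z) * deriv Mj z = -(deriv Wc z / 3 - deriv Sc z - 2 * Sc z) * Pj z + (Λ - (2 / 3 * deriv Wc z + 2 * Wc z - r - 2 * deriv Sc z - 4 * Sc z)) * Mj z) →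
      Pi d = Pj d → Mi d = Mj d → ∀ z ∈ Vi ∩ X, Pi z = Pj z ∧ Mi z = Mj z := by
    intro Vi X d Pi Mi Pj Mj hVi hX hconv hViW h0 hd hPi hMi hsoli hPj hMj hsolj hPd hMd
    have hsubi : Vi ∩ X ⊆ Vi := inter_subset_left
    have hsubj : Vi ∩ X ⊆ sonicWedge ∩ X := inter_subset_inter_left _ hViW
    exact complexChar_agree_on_convex (hVi.inter hX) hconv hd (hsubi.trans hViW) hWc hSc
      (fun z hz => hcp z (hViW hz.1) (h0 z hz.1)) (fun z hz => hcm z (hViW hz.1)) (hPi.mono hsubi) (hMi.mono hsubi)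
      (hPj.mono hsubj) (hMj.mono hsubj) (fun z hz => hsoli z (hsubi hz)) (fun z hz => hsolj z (hsubj hz)) hPd hMd
  have hquarter : δ / 4 < 1 / 20 := by linarith
  set d₁₂ : ℂ := ((-(δ / 4) : ℝ) : ℂ) + ((δ / 4 : ℝ) : ℂ) * Complex.I with hd₁₂
  set d₁₃ : ℂ := ((-(δ / 4) : ℝ) : ℂ) - ((δ / 4 : ℝ) : ℂ) * Complex.I with hd₁₃
  set d₄₂ : ℂ := ((δ / 4 : ℝ) : ℂ) + ((δ / 4 : ℝ) : ℂ) * Complex.I with hd₄₂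
  set d₄₃ : ℂ := ((δ / 4 : ℝ) : ℂ) - ((δ / 4 : ℝ) : ℂ) * Complex.I with hd₄₃
  have hnorm4 : ‖((δ / 4 : ℝ) : ℂ)‖ = δ / 4 ∧ ‖((-(δ / 4) : ℝ) : ℂ)‖ = δ / 4 ∧ ‖((δ / 4 : ℝ) : ℂ) * Complex.I‖ = δ / 4 := by
    refine ⟨?_, ?_, ?_⟩
    · rw [Complex.norm_real, Real.norm_eq_abs, abs_of_pos (by linarith)]
    · rw [Complex.norm_real, Real.norm_eq_abs, abs_of_neg (by linarith)]; ring
    · rw [norm_mul, Complex.norm_I, mul_one, Complex.norm_real, Real.norm_eq_abs, abs_of_pos (by linarith)]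
  have hd₁₂B : d₁₂ ∈ ball (0 : ℂ) δ := by
    rw [mem_ball_zero_iff, hd₁₂]
    calc _ ≤ ‖((-(δ / 4) : ℝ) : ℂ)‖ + ‖((δ / 4 : ℝ) : ℂ) * Complex.I‖ := norm_add_le _ _
      _ < δ := by rw [hnorm4.2.1, hnorm4.2.2]; linarith
  have hd₁₃B : d₁₃ ∈ ball (0 : ℂ) δ := by
    rw [mem_ball_zero_iff, hd₁₃]
    calc _ ≤ ‖((-(δ / 4) : ℝ) : ℂ)‖ + ‖((δ / 4 : ℝ) : ℂ) * Complex.I‖ := norm_sub_le _ _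
      _ < δ := by rw [hnorm4.2.1, hnorm4.2.2]; linarith
  have hd₄₂B : d₄₂ ∈ ball (0 : ℂ) δ := by
    rw [mem_ball_zero_iff, hd₄₂]
    calc _ ≤ ‖((δ / 4 : ℝ) : ℂ)‖ + ‖((δ / 4 : ℝ) : ℂ) * Complex.I‖ := norm_add_le _ _
      _ < δ := by rw [hnorm4.1, hnorm4.2.2]; linarith
  have hd₄₃B : d₄₃ ∈ ball (0 : ℂ) δ := by
    rw [mem_ball_zero_iff, hd₄₃]
    calc _ ≤ ‖((δ / 4 : ℝ) : ℂ)‖ + ‖((δ / 4 : ℝ) : ℂ) * Complex.I‖ := norm_sub_le _ _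
      _ < δ := by rw [hnorm4.1, hnorm4.2.2]; linarith
  have hre₁₂ : d₁₂.re < 0 ∧ 0 < d₁₂.im ∧ d₁₂.im < 1 / 20 := by simp [hd₁₂]; constructor <;> linarith
  have hre₁₃ : d₁₃.re < 0 ∧ d₁₃.im < 0 ∧ -(1 / 20 : ℝ) < d₁₃.im := by simp [hd₁₃]; constructor <;> linarith
  have hre₄₂ : 0 < d₄₂.re ∧ 0 < d₄₂.im ∧ d₄₂.im < 1 / 20 := by simp [hd₄₂]; constructor <;> linarith
  have hre₄₃ : 0 < d₄₃.re ∧ d₄₃.im < 0 ∧ -(1 / 20 : ℝ) < d₄₃.im := by simp [hd₄₃]; constructor <;> linarith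
  have hB12 := agree2 V₁ {z : ℂ | 0 < z.im ∧ z.im < 1 / 20} d₁₂ P₁ M₁ P₂ M₂ hO1
    ((isOpen_lt continuous_const continuous_im).inter (isOpen_lt continuous_im continuous_const))
    (by
      have hEq : V₁ ∩ {z : ℂ | 0 < z.im ∧ z.im < 1 / 20} = V₂ ∩ {z : ℂ | z.re < 0} := by
        ext z; simp only [hV₁, hV₂, mem_inter_iff, mem_setOf_eq]; tauto
      rw [hEq]; exact hC2.inter (convex_halfSpace_re_lt 0))
    inter_subset_left h01 ⟨⟨hBW hd₁₂B, hre₁₂.1⟩, hre₁₂.2⟩ hP₁d hM₁d hsol₁ hP₂d hM₂d hsol₂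
    (((hA1 d₁₂ ⟨hd₁₂B, hre₁₂.1⟩).1).trans ((hA2 d₁₂ ⟨hd₁₂B, hre₁₂.2⟩).1).symm)
    (((hA1 d₁₂ ⟨hd₁₂B, hre₁₂.1⟩).2).trans ((hA2 d₁₂ ⟨hd₁₂B, hre₁₂.2⟩).2).symm)
  have hB13 := agree2 V₁ {z : ℂ | z.im < 0 ∧ -(1 / 20 : ℝ) < z.im} d₁₃ P₁ M₁ P₃ M₃ hO1
    ((isOpen_lt continuous_im continuous_const).inter (isOpen_lt continuous_const continuous_im))
    (by
      have hEq : V₁ ∩ {z : ℂ | z.im < 0 ∧ -(1 / 20 : ℝ) < z.im} = V₃ ∩ {z : ℂ | z.re < 0} := by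
        ext z; simp only [hV₁, hV₃, mem_inter_iff, mem_setOf_eq]; tauto
      rw [hEq]; exact hC3.inter (convex_halfSpace_re_lt 0))
    inter_subset_left h01 ⟨⟨hBW hd₁₃B, hre₁₃.1⟩, hre₁₃.2⟩ hP₁d hM₁d hsol₁ hP₃d hM₃d hsol₃
    (((hA1 d₁₃ ⟨hd₁₃B, hre₁₃.1⟩).1).trans ((hA3 d₁₃ ⟨hd₁₃B, hre₁₃.2⟩).1).symm)
    (((hA1 d₁₃ ⟨hd₁₃B, hre₁₃.1⟩).2).trans ((hA3 d₁₃ ⟨hd₁₃B, hre₁₃.2⟩).2).symm)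
  have hB42 := agree2 V₄ {z : ℂ | 0 < z.im ∧ z.im < 1 / 20} d₄₂ P₄ M₄ P₂ M₂ hO4
    ((isOpen_lt continuous_const continuous_im).inter (isOpen_lt continuous_im continuous_const))
    (by
      have hEq : V₄ ∩ {z : ℂ | 0 < z.im ∧ z.im < 1 / 20} = V₂ ∩ {z : ℂ | 0 < z.re} := by
        ext z; simp only [hV₄, hV₂, mem_inter_iff, mem_setOf_eq]; tauto
      rw [hEq]; exact hC2.inter (convex_halfSpace_re_gt 0))
    inter_subset_left h04 ⟨⟨hBW hd₄₂B, hre₄₂.1⟩, hre₄₂.2⟩ hP₄d hM₄d hsol₄ hP₂d hM₂d hsol₂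
    (((hA4 d₄₂ ⟨hd₄₂B, hre₄₂.1⟩).1).trans ((hA2 d₄₂ ⟨hd₄₂B, hre₄₂.2⟩).1).symm)
    (((hA4 d₄₂ ⟨hd₄₂B, hre₄₂.1⟩).2).trans ((hA2 d₄₂ ⟨hd₄₂B, hre₄₂.2⟩).2).symm)
  have hB43 := agree2 V₄ {z : ℂ | z.im < 0 ∧ -(1 / 20 : ℝ) < z.im} d₄₃ P₄ M₄ P₃ M₃ hO4
    ((isOpen_lt continuous_im continuous_const).inter (isOpen_lt continuous_const continuous_im))
    (by
      have hEq : V₄ ∩ {z : ℂ | z.im < 0 ∧ -(1 / 20 : ℝ) < z.im} = V₃ ∩ {z : ℂ | 0 < z.re} := by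
        ext z; simp only [hV₄, hV₃, mem_inter_iff, mem_setOf_eq]; tauto
      rw [hEq]; exact hC3.inter (convex_halfSpace_re_gt 0))
    inter_subset_left h04 ⟨⟨hBW hd₄₃B, hre₄₃.1⟩, hre₄₃.2⟩ hP₄d hM₄d hsol₄ hP₃d hM₃d hsol₃
    (((hA4 d₄₃ ⟨hd₄₃B, hre₄₃.1⟩).1).trans ((hA3 d₄₃ ⟨hd₄₃B, hre₄₃.2⟩).1).symm)
    (((hA4 d₄₃ ⟨hd₄₃B, hre₄₃.1⟩).2).trans ((hA3 d₄₃ ⟨hd₄₃B, hre₄₃.2⟩).2).symm)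
  -- the glued pair
  set Pg : ℂ → ℂ := fun z => if ‖z‖ < δ then P₀ z else if z.re < 0 then P₁ z else if 0 < z.re then P₄ z else
    if 0 < z.im then P₂ z else P₃ z with hPg
  set Mg : ℂ → ℂ := fun z => if ‖z‖ < δ then M₀ z else if z.re < 0 then M₁ z else if 0 < z.re then M₄ z else
    if 0 < z.im then M₂ z else M₃ z with hMg
  have hg0 : EqOn Pg P₀ (ball 0 δ) ∧ EqOn Mg M₀ (ball 0 δ) := by
    constructor <;> intro w hw <;> have hw' : ‖w‖ < δ := mem_ball_zero_iff.1 hw <;> simp [hPg, hMg, hw']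
  have hg1 : EqOn Pg P₁ V₁ ∧ EqOn Mg M₁ V₁ := by
    constructor <;> intro w hw <;> by_cases hb : ‖w‖ < δ
    · simpa [hPg, hb] using (hA1 w ⟨mem_ball_zero_iff.2 hb, hw.2⟩).1.symm
    · have h2 : w.re < 0 := hw.2; simp [hPg, hb, h2]
    · simpa [hMg, hb] using (hA1 w ⟨mem_ball_zero_iff.2 hb, hw.2⟩).2.symm
    · have h2 : w.re < 0 := hw.2; simp [hMg, hb, h2]
  have hg4 : EqOn Pg P₄ V₄ ∧ EqOn Mg M₄ V₄ := by
    constructor <;> intro w hw <;> by_cases hb : ‖w‖ < δ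
    · simpa [hPg, hb] using (hA4 w ⟨mem_ball_zero_iff.2 hb, hw.2⟩).1.symm
    · have h2 : 0 < w.re := hw.2
      have h3 : ¬ w.re < 0 := not_lt.2 h2.le
      simp [hPg, hb, h2, h3]
    · simpa [hMg, hb] using (hA4 w ⟨mem_ball_zero_iff.2 hb, hw.2⟩).2.symm
    · have h2 : 0 < w.re := hw.2
      have h3 : ¬ w.re < 0 := not_lt.2 h2.le
      simp [hMg, hb, h2, h3]
  have hg2 : EqOn Pg P₂ V₂ ∧ EqOn Mg M₂ V₂ := by
    constructor <;> intro w hw <;> by_cases hb : ‖w‖ < δ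
    · simpa [hPg, hb] using (hA2 w ⟨mem_ball_zero_iff.2 hb, hw.2⟩).1.symm
    · by_cases h2 : w.re < 0
      · simpa [hPg, hb, h2] using (hB12 w ⟨⟨hw.1, h2⟩, hw.2⟩).1
      · by_cases h3 : 0 < w.re
        · simpa [hPg, hb, h2, h3] using (hB42 w ⟨⟨hw.1, h3⟩, hw.2⟩).1
        · have h4 : 0 < w.im := hw.2.1; simp [hPg, hb, h2, h3, h4]
    · simpa [hMg, hb] using (hA2 w ⟨mem_ball_zero_iff.2 hb, hw.2⟩).2.symm
    · by_cases h2 : w.re < 0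
      · simpa [hMg, hb, h2] using (hB12 w ⟨⟨hw.1, h2⟩, hw.2⟩).2
      · by_cases h3 : 0 < w.re
        · simpa [hMg, hb, h2, h3] using (hB42 w ⟨⟨hw.1, h3⟩, hw.2⟩).2
        · have h4 : 0 < w.im := hw.2.1; simp [hMg, hb, h2, h3, h4]
  have hg3 : EqOn Pg P₃ V₃ ∧ EqOn Mg M₃ V₃ := by
    constructor <;> intro w hw <;> by_cases hb : ‖w‖ < δ
    · simpa [hPg, hb] using (hA3 w ⟨mem_ball_zero_iff.2 hb, hw.2⟩).1.symm
    · by_cases h2 : w.re < 0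
      · simpa [hPg, hb, h2] using (hB13 w ⟨⟨hw.1, h2⟩, hw.2⟩).1
      · by_cases h3 : 0 < w.re
        · simpa [hPg, hb, h2, h3] using (hB43 w ⟨⟨hw.1, h3⟩, hw.2⟩).1
        · have h4 : ¬ 0 < w.im := not_lt.2 hw.2.1.le; simp [hPg, hb, h2, h3, h4]
    · simpa [hMg, hb] using (hA3 w ⟨mem_ball_zero_iff.2 hb, hw.2⟩).2.symm
    · by_cases h2 : w.re < 0
      · simpa [hMg, hb, h2] using (hB13 w ⟨⟨hw.1, h2⟩, hw.2⟩).2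
      · by_cases h3 : 0 < w.re
        · simpa [hMg, hb, h2, h3] using (hB43 w ⟨⟨hw.1, h3⟩, hw.2⟩).2
        · have h4 : ¬ 0 < w.im := not_lt.2 hw.2.1.le; simp [hMg, hb, h2, h3, h4]
  -- pointwise: differentiability and the system
  have hpt : ∀ z ∈ sonicWedge, DifferentiableAt ℂ Pg z ∧ DifferentiableAt ℂ Mg z ∧ ((Wc z - 1 + Sc z) * deriv Pg z = (Λ - (2 / 3 * deriv Wc z + 2 * Wc z - r + 2 * deriv Sc z + 4 * Sc z)) * Pg z - (deriv Wc z / 3 + deriv Sc z + 2 * Sc z) * Mg z ∧ (Wc z - 1 - Sc z) * deriv Mg z = -(deriv Wc z / 3 - deriv Sc z - 2 * Sc z) * Pg z + (Λ - (2 / 3 * deriv Wc z + 2 * Wc z - r - 2 * deriv Sc z - 4 * Sc z)) * Mg z) := by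
    intro z hz
    by_cases hb : ‖z‖ < δ
    · exact complexChar_congr_of_eqOn hOB hP₀d hM₀d hsol0 hg0.1 hg0.2 (mem_ball_zero_iff.2 hb)
    · have hz0 : z ≠ 0 := fun h => hb (by rw [h, norm_zero]; exact hδpos)
      rcases sonicWedge_cover hz hz0 with h | h | h | h
      · exact complexChar_congr_of_eqOn hO1 hP₁d hM₁d hsol₁ hg1.1 hg1.2 ⟨hz, h⟩
      · exact complexChar_congr_of_eqOn hO4 hP₄d hM₄d hsol₄ hg4.1 hg4.2 ⟨hz, h⟩
      · exact complexChar_congr_of_eqOn hO2 hP₂d hM₂d hsol₂ hg2.1 hg2.2 ⟨hz, h⟩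
      · exact complexChar_congr_of_eqOn hO3 hP₃d hM₃d hsol₃ hg3.1 hg3.2 ⟨hz, h⟩
  refine ⟨Pg, Mg, fun z hz => (hpt z hz).1.differentiableWithinAt, fun z hz => (hpt z hz).2.1.differentiableWithinAt, ?_,
    fun z hz => (hpt z hz).2.2⟩
  -- the real trace
  have hc₁tr : P₁ c₁ = ŵ (-(δ / 2)) + 3 * ŝ (-(δ / 2)) ∧ M₁ c₁ = ŵ (-(δ / 2)) - 3 * ŝ (-(δ / 2)) := by
    rw [hP₁c, hM₁c]; exact htr0 _ (by rw [abs_of_neg (by linarith)]; linarith)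
  have hc₄tr : P₄ c₄ = ŵ (δ / 2) + 3 * ŝ (δ / 2) ∧ M₄ c₄ = ŵ (δ / 2) - 3 * ŝ (δ / 2) := by
    rw [hP₄c, hM₄c]; exact htr0 _ (by rw [abs_of_pos (by linarith)]; linarith)
  have hleft := realTrace_of_complexChar (a := -(4 / 5)) (b := 0) (x₀ := -(δ / 2)) hO1 inter_subset_left hW hS hWc hSc htr
    (hcp0 V₁ inter_subset_left h01) (hcm0 V₁ inter_subset_left) hŵ hŝ heq hP₁d hM₁d hsol₁
    (fun x hx => (ofReal_mem_sonicWedge_pieces hx.1 (by linarith [hx.2])).1 hx.2) ⟨by linarith, by linarith⟩ hc₁tr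
  have hright := realTrace_of_complexChar (a := 0) (b := 1 / 20) (x₀ := δ / 2) hO4 inter_subset_left hW hS hWc hSc htr
    (hcp0 V₄ inter_subset_left h04) (hcm0 V₄ inter_subset_left) hŵ hŝ heq hP₄d hM₄d hsol₄
    (fun x hx => (ofReal_mem_sonicWedge_pieces (by linarith [hx.1]) hx.2).2 hx.1) ⟨by linarith, by linarith⟩ hc₄tr
  intro x hx1 hx2
  by_cases hb : |x| < δ
  · have hxB : (x : ℂ) ∈ ball (0 : ℂ) δ := by rwa [mem_ball_zero_iff, Complex.norm_real, Real.norm_eq_abs]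
    rw [hg0.1 hxB, hg0.2 hxB]
    exact htr0 x hb
  · rcases lt_or_gt_of_ne (show x ≠ 0 from fun h => hb (by rw [h, abs_zero]; exact hδpos)) with hx | hx
    · have hxV : (x : ℂ) ∈ V₁ := (ofReal_mem_sonicWedge_pieces hx1 hx2).1 hx
      rw [hg1.1 hxV, hg1.2 hxV]
      exact hleft x ⟨hx1, hx⟩
    · have hxV : (x : ℂ) ∈ V₄ := (ofReal_mem_sonicWedge_pieces hx1 hx2).2 hx
      rw [hg4.1 hxV, hg4.2 hxV]
      exact hright x ⟨hx, hx2⟩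

end Summit.AtomisticToContinuum.HydrodynamicLimit.Theorems.SonicCavityRenewal

end
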